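import Summits.MatrixMultiplication.MatrixMultiplication.Theorems.SoloInformedFibreLines

/-!
# Plane bounds and the pair-counting reduction of C3 (m = 2) to generic pairs — every host

This work, §8.7 (m). Setting of `SoloInformedFibreLines`: a realization of `⟨n,n,n⟩` (CohnUmans2013,
arXiv:1207.6528, Def. 12) in `𝒮(S⁰ × S¹, ±)` = flat chart `F⁰(i,j,k) = fᵢ + gⱼ + lₖ` + twisted data
`a, b, c` with (E) everywhere and (Sep) on every ordered pair of distinct triples in one `F⁰`-fibre;
`r = (|S¹|+1)/2`; `N₀` = number of fibres; rank `= r·|S⁰| ≥ r·N₀`.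

**Pair counting.** By Cauchy–Schwarz `N₀ ≥ n⁶ / (n³ + Z)` where `Z = Σ_s |Λ_s|(|Λ_s| - 1)` is the number
of ordered same-fibre pairs, i.e. of non-MM cell triples `((i,j),(j',k),(k',i'))` with
`F⁰(i,j,k) = F⁰(i',j',k')`. So `Z ≤ C·r·n³` would give C3 for `m = 2` with `rank ≥ n³/(C+1)`, and the lazy
family has `Z = (r-1)n³` exactly. This file bounds the pairs with an INDEX COINCIDENCE:

* `kPlane_class_ne`: `k = k'` ⟹ `a(i,j) ≠ ± a(i',j')` — the mixed cells are `a(τ)` and the own `b`, `c`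
  cells of `τ'`; so a fibre meets every `k`-plane in `≤ r` triples (`kPlane_card`), and the full class map
  `(i,j) ↦ (a⁰(i,j), [a¹(i,j)])` is injective;
* `jPlane_class_ne`: `j = j'` ⟹ `c(k',i') ≠ ± c(k,i)`; `≤ r` triples per `j`-plane (`jPlane_card`);
* `iPlane_class_ne`: `i = i'` ⟹ the ANTI-DIAGONAL cells `b(j',k)`, `b(j,k')` are sign-distinct (compare (E)
  at `(i,j,k')`); equivalently the `b⁰`-fibres of `J × K` carry sign-distinct `b¹`-values, so (switching
  anti-diagonals, a bijection on unordered cell pairs) the `i`-plane pairs number `≤ (r-1)n³` as well.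

Hence `Z_coincident ≤ 3(r-1)n³` for EVERY host and
`N₀ ≥ n⁶ / ((3r-2)n³ + Z₀)`, `Z₀` := the number of GENERIC same-fibre ordered pairs (no common index):
Conjecture C3 for one involutory multiplier is reduced to `Z₀ = O(r·n³)` — the global price of
transversal-like fibres, which by §8.7 (k) obey no local bound. References: this work §8.7 (k)–(m);
CohnUmans2013 Def. 12.
-/

namespace Summit.MatrixMultiplication.MatrixMultiplication.Theorems.TwistedTPP

namespace FibreLines

variable {ι G : Type*} [AddCommGroup G]

/-- Variant of the core computation with the MIDDLE entry varying: if `x ± v ± w ≠ 0` for all patterns and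
`x ± v' ± w = 0` for some pattern then `v ≠ ± v'`. [this work, §8.7 (m)] -/
theorem mid_ne_and_ne_neg_of_sep {x v v' w : G}
    (hx : x + v + w ≠ 0 ∧ x + v - w ≠ 0 ∧ x - v + w ≠ 0 ∧ x - v - w ≠ 0)
    (hy : x + v' + w = 0 ∨ x + v' - w = 0 ∨ x - v' + w = 0 ∨ x - v' - w = 0) :
    v ≠ v' ∧ v ≠ -v' := by
  obtain ⟨h₁, h₂, h₃, h₄⟩ := hx
  refine ⟨?_, ?_⟩
  · rintro rfl
    rcases hy with h | h | h | h
    · exact h₁ h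
    · exact h₂ h
    · exact h₃ h
    · exact h₄ h
  · rintro rfl
    rcases hy with h | h | h | h
    · apply h₃
      rw [sub_neg_eq_add, h]
    · apply h₄
      have : x - -v' - w = x + v' - w := by abel
      rw [this, h]
    · apply h₁
      rw [← sub_eq_add_neg, h]
    · apply h₂
      have : x + -v' - w = x - v' - w := by abel
      rw [this, h]

/-- **`k`-planes.** If `τ = (i,j,k)` and `τ' = (i',j',k)` (same third index) are separated then
`a(i,j) ≠ ± a(i',j')`: the mixed cells of `τ ← τ'` are `a(i,j)` and the OWN cells `b(j',k)`, `c(k,i')`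
of `τ'`, and (E) holds at `τ'`. Consequently the class map `(i,j) ↦ (a⁰(i,j), [a¹(i,j)])` is injective
and a fibre meets every `k`-plane in at most `r` triples. [this work, §8.7 (m)] -/
theorem kPlane_class_ne (D : Data ι G) {i j k i' j' : ι} (h : D.Sep i j k i' j' k) :
    D.a i j ≠ D.a i' j' ∧ D.a i j ≠ -D.a i' j' :=
  ne_and_ne_neg_of_sep h (D.eqn i' j' k)

/-- **`j`-planes.** If `τ = (i,j,k)` and `τ' = (i',j,k')` (same second index) are separated then
`c(k',i') ≠ ± c(k,i)`: the mixed cells are the own cells `a(i,j)`, `b(j,k)` of `τ` and `c(k',i')`, and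
(E) holds at `τ`. [this work, §8.7 (m)] -/
theorem jPlane_class_ne (D : Data ι G) {i j k i' k' : ι} (h : D.Sep i j k i' j k') :
    D.c k' i' ≠ D.c k i ∧ D.c k' i' ≠ -D.c k i := by
  obtain ⟨h₁, h₂, h₃, h₄⟩ := h
  refine ⟨?_, ?_⟩
  · intro e
    rw [e] at h₁ h₂ h₃ h₄
    rcases D.eqn i j k with h | h | h | h
    · exact h₁ h
    · exact h₂ h
    · exact h₃ h
    · exact h₄ h
  · intro e
    rw [e] at h₁ h₂ h₃ h₄
    rcases D.eqn i j k with h | h | h | h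
    · apply h₂
      rw [sub_neg_eq_add, h]
    · apply h₁
      rw [← sub_eq_add_neg, h]
    · apply h₄
      rw [sub_neg_eq_add, h]
    · apply h₃
      rw [← sub_eq_add_neg, h]

/-- **`i`-planes.** If `τ = (i,j,k)` and `τ' = (i,j',k')` (same first index) are separated then the
ANTI-DIAGONAL `b`-cells are sign-distinct: `b(j',k) ≠ ± b(j,k')` — compare (E) at `(i,j,k')`, which has
the same `a(i,j)` and `c(k',i)`. In chart terms: `b⁰(j',k) = b⁰(j,k')` exactly when `τ, τ'` share a fibre,
so the `b⁰`-fibres of `J × K` carry pairwise sign-distinct `b¹`-values. [this work, §8.7 (m)] -/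
theorem iPlane_class_ne (D : Data ι G) {i j k j' k' : ι} (h : D.Sep i j k i j' k') :
    D.b j' k ≠ D.b j k' ∧ D.b j' k ≠ -D.b j k' :=
  mid_ne_and_ne_neg_of_sep h (D.eqn i j k')

/-- **Plane bound, `k`-direction.** If the triples `(p.1, p.2, k)`, `p ∈ T ⊆ I × J`, are pairwise
separated (as inside one fibre) then `2·#T ≤ |S¹| + 1`, i.e. `#T ≤ r`. [this work, §8.7 (m)] -/
theorem kPlane_card [Fintype G] [DecidableEq G] (hG : ∀ x : G, x = -x → x = 0) (D : Data ι G)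
    (k : ι) (T : Finset (ι × ι))
    (h : ∀ p ∈ T, ∀ p' ∈ T, p ≠ p' → D.Sep p.1 p.2 k p'.1 p'.2 k) :
    2 * T.card ≤ Fintype.card G + 1 :=
  two_mul_card_le_of_signInjOn hG (fun p => D.a p.1 p.2) T
    (fun u hu v hv huv => kPlane_class_ne D (h u hu v hv huv))

/-- **Plane bound, `j`-direction.** Triples `(p.1, j, p.2)`, `p ∈ T ⊆ I × K`, pairwise separated ⟹
`2·#T ≤ |S¹| + 1`. [this work, §8.7 (m)] -/
theorem jPlane_card [Fintype G] [DecidableEq G] (hG : ∀ x : G, x = -x → x = 0) (D : Data ι G)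
    (j : ι) (T : Finset (ι × ι))
    (h : ∀ p ∈ T, ∀ p' ∈ T, p ≠ p' → D.Sep p.1 j p.2 p'.1 j p'.2) :
    2 * T.card ≤ Fintype.card G + 1 :=
  two_mul_card_le_of_signInjOn hG (fun p => D.c p.2 p.1) T
    (fun u hu v hv huv => by
      have := jPlane_class_ne D (h v hv u hu (Ne.symm huv))
      exact ⟨this.1, this.2⟩)

/-- **Full class-injectivity of `a`** (the `k`-plane lemma read for two arbitrary `A`-cells): if for some
`k` the pair `(i,j,k) ← (i',j',k)` is separated — which (Sep) grants whenever `a⁰(i,j) = a⁰(i',j')` and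
`(i,j) ≠ (i',j')` — then the `S¹`-classes differ. With `|a⁰(I×J)| ≤ |S⁰|` this is the familiar
`n² ≤ r·|S⁰| = rank`. [this work, §8.7 (m)] -/
theorem a_classInjective (D : Data ι G) (k : ι) (T : Finset (ι × ι))
    (h : ∀ p ∈ T, ∀ p' ∈ T, p ≠ p' → D.Sep p.1 p.2 k p'.1 p'.2 k) :
    Set.InjOn (fun p : ι × ι => D.a p.1 p.2) T := by
  intro u hu v hv e
  by_contra hne
  exact (kPlane_class_ne D (h u hu v hv hne)).1 e

end FibreLines

end Summit.MatrixMultiplication.MatrixMultiplication.Theorems.TwistedTPP
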